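/-
Copyright: the b2b-balaban T⁴-continuum CRUX team, row NE7b OWNER lineage `t4-ne7b-p1` (gen 123). Project licence.
-/
import Summits.QuantumFields.BalabanUV.T4Continuum.Spine.NE7b.SupZdExponentialSums
import Summits.QuantumFields.BalabanUV.T4Continuum.Spine.NE7b.SupZdCoarseSymmetry

/-!
# THE INFINITE-VOLUME PROPAGATOR IS AN EXPONENTIALLY DECAYING KERNEL OPERATOR: on `ℤ^d`, the bounded point columns `G(·, q)` of `H_V`
# (`V : ℤ^d → [−λ, Λ]`, `d ≥ 3`) satisfy `|G(p, q)| ≤ C·e^{−δ|blk n p − blk n q|₁} ≤ C·e^{dδ}·e^{−(δ∕(n+1))|p − q|₁}`, their rows against a bounded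
# `f` converge absolutely, and the kernel sum `p ↦ Σ′_q G(p, q)f(q)` IS the bounded solution of `H_Vu = f` — so every bounded solution (in
# particular (188)'s `G_Vf`) has the kernel representation `u(p) = Σ′_q G(p,q)f(q)` (row NE7b, node U5c; (179)∕(180)∕(181)∕(187)∕(189) BY
# NAME; [folklore])

Cell `pub-balaban`, sub-cell `t4`, spine estimate NE7b (`T4WeightBudget.RelWeightBound`; the cell's OWN estimate — NOT PRINTED in
[Bałaban 1983–89], NOT PROVED).  Crux-route work under `Spine/NE7b/` by the row OWNER (`t4-ne7b-p1` gen 123, file (190)) under FREEZE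
(0)'s crux-prover clause; NOTHING of Bałaban's is named as a Lean object, valued or asserted; no `T4Continuum/Support` leaf typed; no `def`,
no notation (the `ℤ^d` operator DISPLAYED; `G` is ANY family of bounded point columns); zero `sorry`.  Imports (BY NAME): the OWNER's (189)
`…SupZdExponentialSums` (`summable_exp_l1`, `finset_sum_exp_l1_le`; through it (180) `zd_propagator_exists`, (181)
`zd_bounded_solution_unique`, (179) `abs_le_side_mul`), (187) `…SupZdCoarseSymmetry` (nothing beyond the import chain), Mathlib's
`Summable.of_norm_bounded`, `Summable.tsum_add`, `Summable.tsum_sub`, `tsum_mul_left`, `Summable.tsum_finsetSum`, `tsum_eq_single`.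

WHY (located).  (188) made `H_V⁻¹` an operator on `ℓ^∞(ℤ^d)`; the road's estimates are written with KERNELS (`Σ_q G(p,q)f(q)`, row sums,
conjugated row sums — (162)∕(163)'s currency).  The point columns decay at the block scale ((180) + (181)); a block-scale profile is a
fine-scale profile at the rate `δ∕(n+1)` up to `e^{dδ}` (§1, (179)'s block bookkeeping), so the rows are absolutely summable against bounded `f`
((189) `summable_exp_l1`); the displayed operator is a FINITE stencil, so it passes through the absolutely convergent kernel sum term by term,
where `Σ′_q (H_VG(·,q))(p)f(q) = Σ′_q 𝟙[p = q]f(q) = f(p)`; the kernel sum is bounded, hence it IS the bounded solution ((181)).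

WHAT IS PROVED ([folklore]; `X d = ℤ^d`; the `ℤ^d` operator `(H_V u)(p) = (n+1)²Σ_μ(2u p − u(p + ê_μ) − u(p − ê_μ)) + a(n+1)^{−d}Σ_{q′ ∈ B n (blk n p)}u q′
+ V p·u p` DISPLAYED; `G : X d → X d → ℝ`, `G q` the point column AT `q`, i.e. `H_V(G q) = 𝟙_q`, `|G q p| ≤ B_q`):
* §1 `exp_blockDist_le` (`e^{−δ|blk n p − blk n q|₁} ≤ e^{dδ}e^{−(δ∕(n+1))|p − q|₁}`).
* §2 **`zd_pointColumn_decay`** (`∃ C δ > 0` from `(d, a, λ, Λ)`: `|G q p| ≤ C·e^{−δ|blk n p − blk n q|₁}`).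
* §3 **`zd_kernel_row_summable`** (`|f| ≤ M` ⟹ `q ↦ G q p·f q` summable at every `p`, with `Σ′_q|…| ≤ C·e^{dδ}K_{δ∕(n+1)}·M`).
* §4 **`zd_kernel_representation`**: for `|f| ≤ M` the kernel sum `p ↦ Σ′_q G q p·f q` solves `H_Vu = f` and is bounded; every bounded
  solution `u` of `H_Vu = f` satisfies `u p = Σ′_q G q p·f q` at every `p`.
* §5 toy (`d = 3`).

HONEST (what this is NOT).  The row constant `e^{dδ}K_{δ∕(n+1)}` is mesh-DEPENDENT (a counting bound; the mesh-free `ℓ^∞` bound is (180)∕(188));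
`d ≥ 3` only; the LINEAR column only; scalar skeleton ((A3), NC-NE7b-α UNRULED); nothing of the covariant propagators of [B4]–[B6]; nothing of
Bałaban's.  BY-NAME EFFECT ON THE WALL: NONE.  NE7b NOT PRINTED ∕ NOT PROVED; spine PROVED 0∕9; rung (B)+1 — the programme's measures
remain FINITE-torus statements; NOT the mass gap, NOT Clay.  HONEST DEPENDENCY: continuum YM on T⁴ ⇐ BetaPertH ∧ nine spine estimates
(0∕9 proved); BetaPertH ⇐ (D1) ∧ (D4) ∧ CAP+tail; G-an2-4 gates asym, D1 and NE2∕3∕4.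
-/

set_option autoImplicit false

noncomputable section

namespace Summit.QuantumFields.BalabanUV.T4Continuum.NE7b.SupZdPropagatorKernel

open Real Filter Topology
open Literature.MathematicalPhysics.QuantumFieldTheory.Balaban1983to89
open B6QGQLower276 (X e blk B side side_facts chart mem_B sum_B sum_B_const card_cube blk_chart)
open Beta (Site siteOf windowMap)
open SupTorusTowerComparison (abs_le_side_mul)
open SupZdPropagatorLimit (zd_propagator_exists)
open SupZdPropagatorUniqueness (zd_bounded_solution_unique)
open SupZdExponentialSums (summable_exp_l1 finset_sum_exp_l1_le tsum_exp_l1_le)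

variable {d : ℕ}

/-! ## §1. A block-scale profile is a fine-scale profile -/

/-- **`e^{−δ|blk n p − blk n q|₁} ≤ e^{dδ}·e^{−(δ∕(n+1))|p − q|₁}`** (`δ ≥ 0`): `|p i − q i| ≤ (n+1)|blk n p i − blk n q i| + n` coordinatewise
((179) `abs_le_side_mul`). [folklore] -/
theorem exp_blockDist_le (n : ℕ) {δ : ℝ} (hδ : 0 ≤ δ) (p q : X d) :
    exp (-(δ * ∑ i, (((blk n p i - blk n q i).natAbs : ℕ) : ℝ)))
      ≤ exp (d * δ) * exp (-(δ / ((n : ℝ) + 1) * ∑ i, (((p i - q i).natAbs : ℕ) : ℝ))) := by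
  have hn : (0 : ℝ) < (n : ℝ) + 1 := by positivity
  rw [← exp_add]
  refine exp_le_exp.2 ?_
  -- coordinatewise `|p i − q i| ≤ (n+1)(|blk p i − blk q i| + 1)`
  have hcoord : ∀ i, (((p i - q i).natAbs : ℕ) : ℝ) ≤ ((n : ℝ) + 1) * ((((blk n p i - blk n q i).natAbs : ℕ) : ℝ) + 1) := by
    intro i
    obtain ⟨-, hr0, hr1, hp⟩ := abs_le_side_mul n p i
    obtain ⟨-, hs0, hs1, hq⟩ := abs_le_side_mul n q i
    set rp : ℤ := p i % side n with hrp
    set rq : ℤ := q i % side n with hrq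
    have hside : side n = (n : ℤ) + 1 := rfl
    have e1 : p i - q i = side n * (blk n p i - blk n q i) + (rp - rq) := by rw [hp, hq]; ring
    have h1 : |p i - q i| ≤ ((n : ℤ) + 1) * |blk n p i - blk n q i| + n := by
      rw [e1]
      refine (abs_add_le _ _).trans ?_
      rw [abs_mul, hside, abs_of_nonneg (by positivity : (0 : ℤ) ≤ (n : ℤ) + 1)]
      have : |rp - rq| ≤ n := by rw [hside] at hr1 hs1; rw [abs_le]; constructor <;> linarith
      linarith
    rw [← Int.natCast_natAbs, ← Int.natCast_natAbs] at h1
    have h2 : (((p i - q i).natAbs : ℕ) : ℝ) ≤ ((n : ℝ) + 1) * (((blk n p i - blk n q i).natAbs : ℕ) : ℝ) + n := by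
      exact_mod_cast h1
    nlinarith [Nat.cast_nonneg (α := ℝ) ((blk n p i - blk n q i).natAbs)]
  have hsum : ∑ i, (((p i - q i).natAbs : ℕ) : ℝ) ≤ ((n : ℝ) + 1) * (∑ i, (((blk n p i - blk n q i).natAbs : ℕ) : ℝ) + d) := by
    calc ∑ i, (((p i - q i).natAbs : ℕ) : ℝ) ≤ ∑ i, ((n : ℝ) + 1) * ((((blk n p i - blk n q i).natAbs : ℕ) : ℝ) + 1) :=
          Finset.sum_le_sum fun i _ => hcoord i
      _ = ((n : ℝ) + 1) * (∑ i, (((blk n p i - blk n q i).natAbs : ℕ) : ℝ) + d) := by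
          rw [← Finset.mul_sum, Finset.sum_add_distrib]; simp
  have h5 : δ / ((n : ℝ) + 1) * ∑ i, (((p i - q i).natAbs : ℕ) : ℝ) ≤ δ * (∑ i, (((blk n p i - blk n q i).natAbs : ℕ) : ℝ) + d) := by
    calc δ / ((n : ℝ) + 1) * ∑ i, (((p i - q i).natAbs : ℕ) : ℝ)
        ≤ δ / ((n : ℝ) + 1) * (((n : ℝ) + 1) * (∑ i, (((blk n p i - blk n q i).natAbs : ℕ) : ℝ) + d)) :=
          mul_le_mul_of_nonneg_left hsum (by positivity)
      _ = δ * (∑ i, (((blk n p i - blk n q i).natAbs : ℕ) : ℝ) + d) := by field_simp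
  linarith

/-! ## §2. The point columns decay at the block scale -/

/-- **`|G(p, q)| ≤ C·e^{−δ|blk n p − blk n q|₁}`** for ANY bounded point columns of `H_V` on `ℤ^d` (`V : ℤ^d → [−λ, Λ]`, `d ≥ 3`): the point source
at `q` is a block source in `blk n q`, so (180)'s decaying solution exists and (181) identifies it with `G q`. [folklore] -/
theorem zd_pointColumn_decay (hd : 3 ≤ d) (a : ℝ) (ha : 0 < a) {lam Lam : ℝ} (hlam : lam < min 2 a) (hLam : 0 ≤ Lam) :
    ∃ C δ : ℝ, 0 < C ∧ 0 < δ ∧ ∀ (n : ℕ) (V : X d → ℝ), (∀ p, -lam ≤ V p) → (∀ p, V p ≤ Lam) →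
      ∀ (G : X d → X d → ℝ) (BG : X d → ℝ), (∀ q p, |G q p| ≤ BG q) →
      (∀ q p, ((n : ℝ) + 1) ^ 2 * ∑ μ, (2 * G q p - G q (p + e μ) - G q (p - e μ))
        + a / ((n : ℝ) + 1) ^ d * ∑ q' ∈ B n (blk n p), G q q' + V p * G q p = if p = q then 1 else 0) →
      ∀ q p : X d, |G q p| ≤ C * exp (-(δ * ∑ i, (((blk n p i - blk n q i).natAbs : ℕ) : ℝ))) := by
  obtain ⟨C, δ, hC, hδ, H180⟩ := zd_propagator_exists (d := d) hd a ha hlam hLam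
  refine ⟨C, δ, hC, hδ, ?_⟩
  intro n V hV hV' G BG hGB hG q p
  obtain ⟨v, hveq, hvdec⟩ := H180 n V hV hV' (blk n q) 1 (fun p' => if p' = q then (1 : ℝ) else 0)
    (fun p' hp' => by rw [if_neg]; intro h; exact hp' (by rw [h])) (fun p' => by split_ifs <;> simp)
  have hvB : ∀ p', |v p'| ≤ C * 1 := fun p' => by
    have h := hvdec p'
    have h1 : (1 : ℝ) ≤ exp (δ * ∑ i, (((blk n p' i - blk n q i).natAbs : ℕ) : ℝ)) := one_le_exp (by positivity)
    nlinarith [abs_nonneg (v p')]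
  have hGv : G q = v := zd_bounded_solution_unique hd a ha hlam hLam n V hV hV' _ (G q) v (hGB q) hvB (hG q) hveq
  have h := hvdec p
  rw [← hGv, mul_one] at h
  have hE := exp_pos (δ * ∑ i, (((blk n p i - blk n q i).natAbs : ℕ) : ℝ))
  rw [exp_neg, ← div_eq_mul_inv, le_div_iff₀ hE, mul_comm]; exact h

/-! ## §3. The rows of the kernel against a bounded function converge absolutely -/

/-- **ABSOLUTE CONVERGENCE OF `Σ_q G(p,q)f(q)`**: `|G q p| ≤ C·e^{−δ|blk n p − blk n q|₁}` (`δ > 0`) and `|f| ≤ M` ⟹ `q ↦ G q p·f q` is summable at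
every `p` and `Σ′_q |G q p·f q| ≤ C·e^{dδ}·K_{δ∕(n+1)}·M` (§1 + (189) `summable_exp_l1`). [folklore] -/
theorem zd_kernel_row_summable (n : ℕ) {C δ M : ℝ} (hδ : 0 < δ) (G : X d → X d → ℝ)
    (hGd : ∀ q p, |G q p| ≤ C * exp (-(δ * ∑ i, (((blk n p i - blk n q i).natAbs : ℕ) : ℝ)))) (f : X d → ℝ) (hf : ∀ q, |f q| ≤ M)
    (p : X d) :
    Summable (fun q => G q p * f q) ∧
      ∑' q : X d, |G q p * f q| ≤ C * exp (d * δ) * (2 * (1 - exp (-(δ / ((n : ℝ) + 1))))⁻¹) ^ d * M := by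
  have hM : 0 ≤ M := (abs_nonneg _).trans (hf p)
  have hC : 0 ≤ C := by
    have h := (abs_nonneg _).trans (hGd p p)
    exact le_of_mul_le_mul_right (by rw [zero_mul]; exact h) (exp_pos _)
  have hδ' : 0 < δ / ((n : ℝ) + 1) := by positivity
  have hterm : ∀ q, |G q p * f q| ≤ C * exp (d * δ) * M * exp (-(δ / ((n : ℝ) + 1) * ∑ i, (((p i - q i).natAbs : ℕ) : ℝ))) := by
    intro q
    rw [abs_mul]
    calc |G q p| * |f q| ≤ C * exp (-(δ * ∑ i, (((blk n p i - blk n q i).natAbs : ℕ) : ℝ))) * M :=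
          mul_le_mul (hGd q p) (hf q) (abs_nonneg _) (le_trans (abs_nonneg _) (hGd q p))
      _ ≤ C * (exp (d * δ) * exp (-(δ / ((n : ℝ) + 1) * ∑ i, (((p i - q i).natAbs : ℕ) : ℝ)))) * M :=
          mul_le_mul_of_nonneg_right (mul_le_mul_of_nonneg_left (exp_blockDist_le n hδ.le p q) hC) hM
      _ = _ := by ring
  have hdom : Summable fun q : X d => C * exp (d * δ) * M * exp (-(δ / ((n : ℝ) + 1) * ∑ i, (((p i - q i).natAbs : ℕ) : ℝ))) :=
    (summable_exp_l1 hδ' p).mul_left _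
  have hsum : Summable (fun q => G q p * f q) :=
    Summable.of_norm_bounded hdom fun q => by rw [Real.norm_eq_abs]; exact hterm q
  refine ⟨hsum, ?_⟩
  have habs : Summable (fun q => |G q p * f q|) := hsum.abs
  have k1 : ∑' q : X d, |G q p * f q| ≤ ∑' q : X d, C * exp (d * δ) * M * exp (-(δ / ((n : ℝ) + 1) * ∑ i, (((p i - q i).natAbs : ℕ) : ℝ))) :=
    habs.tsum_le_tsum hterm hdom
  have k2 : ∑' q : X d, C * exp (d * δ) * M * exp (-(δ / ((n : ℝ) + 1) * ∑ i, (((p i - q i).natAbs : ℕ) : ℝ)))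
      = C * exp (d * δ) * M * ∑' q : X d, exp (-(δ / ((n : ℝ) + 1) * ∑ i, (((p i - q i).natAbs : ℕ) : ℝ))) :=
    (summable_exp_l1 hδ' p).tsum_mul_left (C * exp (d * δ) * M)
  have k3 : C * exp (d * δ) * M * ∑' q : X d, exp (-(δ / ((n : ℝ) + 1) * ∑ i, (((p i - q i).natAbs : ℕ) : ℝ)))
      ≤ C * exp (d * δ) * M * (2 * (1 - exp (-(δ / ((n : ℝ) + 1))))⁻¹) ^ d :=
    mul_le_mul_of_nonneg_left (tsum_exp_l1_le hδ' p) (by positivity)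
  have k4 : C * exp (d * δ) * M * (2 * (1 - exp (-(δ / ((n : ℝ) + 1))))⁻¹) ^ d
      = C * exp (d * δ) * (2 * (1 - exp (-(δ / ((n : ℝ) + 1))))⁻¹) ^ d * M := by ring
  exact (k1.trans (k2.le.trans k3)).trans k4.le

/-! ## §4. THE END: the kernel representation of the bounded solution -/

/-- **HEADLINE — `u(p) = Σ′_q G(p,q)f(q)` FOR EVERY BOUNDED SOLUTION OF `H_Vu = f` ON `ℤ^d`** (`V : ℤ^d → [−λ, Λ]`, `|f| ≤ M`, `d ≥ 3`, ANY bounded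
point columns `G q` with `H_V(G q) = 𝟙_q`): the kernel sum converges absolutely (§3), is bounded, and solves the equation (the displayed operator
is a finite stencil and passes through the sum, where `Σ′_q (H_VG q)(p)f(q) = f(p)`), so (181) identifies it with `u`. [folklore] -/
theorem zd_kernel_representation (hd : 3 ≤ d) (a : ℝ) (ha : 0 < a) {lam Lam : ℝ} (hlam : lam < min 2 a) (hLam : 0 ≤ Lam)
    (n : ℕ) (V : X d → ℝ) (hV : ∀ p, -lam ≤ V p) (hV' : ∀ p, V p ≤ Lam)
    (G : X d → X d → ℝ) (BG : X d → ℝ) (hGB : ∀ q p, |G q p| ≤ BG q)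
    (hG : ∀ q p, ((n : ℝ) + 1) ^ 2 * ∑ μ, (2 * G q p - G q (p + e μ) - G q (p - e μ))
      + a / ((n : ℝ) + 1) ^ d * ∑ q' ∈ B n (blk n p), G q q' + V p * G q p = if p = q then 1 else 0)
    {M : ℝ} (f : X d → ℝ) (hf : ∀ q, |f q| ≤ M) (u : X d → ℝ) {Bu : ℝ} (huB : ∀ p, |u p| ≤ Bu)
    (hu : ∀ p, ((n : ℝ) + 1) ^ 2 * ∑ μ, (2 * u p - u (p + e μ) - u (p - e μ))
      + a / ((n : ℝ) + 1) ^ d * ∑ q' ∈ B n (blk n p), u q' + V p * u p = f p) :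
    ∀ p, u p = ∑' q : X d, G q p * f q := by
  classical
  obtain ⟨C, δ, hC, hδ, H2⟩ := zd_pointColumn_decay (d := d) hd a ha hlam hLam
  have hGd : ∀ q p, |G q p| ≤ C * exp (-(δ * ∑ i, (((blk n p i - blk n q i).natAbs : ℕ) : ℝ))) := H2 n V hV hV' G BG hGB hG
  -- summability of the kernel rows everywhere, and the bound of the kernel sum
  have hs : ∀ x : X d, Summable (fun q => G q x * f q) := fun x => (zd_kernel_row_summable n hδ G hGd f hf x).1
  have hAB : ∀ x, |∑' q : X d, G q x * f q| ≤ C * exp (d * δ) * (2 * (1 - exp (-(δ / ((n : ℝ) + 1))))⁻¹) ^ d * M := fun x => by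
    have h := (zd_kernel_row_summable n hδ G hGd f hf x).2
    have h1 : |∑' q : X d, G q x * f q| ≤ ∑' q : X d, |G q x * f q| := by
      have := norm_tsum_le_tsum_norm (hs x).norm
      simpa only [Real.norm_eq_abs] using this
    exact h1.trans h
  -- the kernel sum solves the equation: the finite stencil passes through the absolutely convergent sum
  have hAeq : ∀ p, ((n : ℝ) + 1) ^ 2 * ∑ μ, (2 * (∑' q : X d, G q p * f q) - (∑' q : X d, G q (p + e μ) * f q) - (∑' q : X d, G q (p - e μ) * f q))
      + a / ((n : ℝ) + 1) ^ d * ∑ q' ∈ B n (blk n p), (∑' q : X d, G q q' * f q) + V p * (∑' q : X d, G q p * f q) = f p := by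
    intro p
    -- termwise: `(H_V G q)(p)·f q`, summed over `q`, is `f p`
    have hpt : ∑' q : X d, (((n : ℝ) + 1) ^ 2 * ∑ μ, (2 * (G q p * f q) - G q (p + e μ) * f q - G q (p - e μ) * f q)
        + a / ((n : ℝ) + 1) ^ d * ∑ q' ∈ B n (blk n p), G q q' * f q + V p * (G q p * f q)) = f p := by
      have e1 : ∀ q, ((n : ℝ) + 1) ^ 2 * ∑ μ, (2 * (G q p * f q) - G q (p + e μ) * f q - G q (p - e μ) * f q)
          + a / ((n : ℝ) + 1) ^ d * ∑ q' ∈ B n (blk n p), G q q' * f q + V p * (G q p * f q)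
          = (if p = q then 1 else 0) * f q := by
        intro q
        rw [← hG q p]
        have e2 : ∑ μ, (2 * (G q p * f q) - G q (p + e μ) * f q - G q (p - e μ) * f q)
            = (∑ μ, (2 * G q p - G q (p + e μ) - G q (p - e μ))) * f q := by
          rw [Finset.sum_mul]; exact Finset.sum_congr rfl fun μ _ => by ring
        have e3 : ∑ q' ∈ B n (blk n p), G q q' * f q = (∑ q' ∈ B n (blk n p), G q q') * f q := by rw [Finset.sum_mul]
        rw [e2, e3]; ring
      simp only [e1]
      rw [tsum_eq_single p (fun q hq => by rw [if_neg (Ne.symm hq), zero_mul]), if_pos rfl, one_mul]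
    -- the stencil pieces are summable
    have hS1 : ∀ μ : Fin d, Summable fun q => 2 * (G q p * f q) - G q (p + e μ) * f q - G q (p - e μ) * f q :=
      fun μ => (((hs p).mul_left 2).sub (hs (p + e μ))).sub (hs (p - e μ))
    have hS1s : Summable fun q => ∑ μ, (2 * (G q p * f q) - G q (p + e μ) * f q - G q (p - e μ) * f q) :=
      summable_sum fun μ _ => hS1 μ
    have hS2 : Summable fun q => ∑ q' ∈ B n (blk n p), G q q' * f q := summable_sum fun q' _ => hs q'
    -- and the sum splits along the stencil
    have hT1 : ∑' q : X d, ∑ μ, (2 * (G q p * f q) - G q (p + e μ) * f q - G q (p - e μ) * f q)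
        = ∑ μ, (2 * (∑' q : X d, G q p * f q) - (∑' q : X d, G q (p + e μ) * f q) - (∑' q : X d, G q (p - e μ) * f q)) := by
      rw [Summable.tsum_finsetSum fun μ _ => hS1 μ]
      refine Finset.sum_congr rfl fun μ _ => ?_
      rw [(((hs p).mul_left 2).sub (hs (p + e μ))).tsum_sub (hs (p - e μ)), ((hs p).mul_left 2).tsum_sub (hs (p + e μ)),
        (hs p).tsum_mul_left 2]
    have hT2 : ∑' q : X d, ∑ q' ∈ B n (blk n p), G q q' * f q = ∑ q' ∈ B n (blk n p), ∑' q : X d, G q q' * f q :=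
      Summable.tsum_finsetSum fun q' _ => hs q'
    have hmain : ∑' q : X d, (((n : ℝ) + 1) ^ 2 * ∑ μ, (2 * (G q p * f q) - G q (p + e μ) * f q - G q (p - e μ) * f q)
        + a / ((n : ℝ) + 1) ^ d * ∑ q' ∈ B n (blk n p), G q q' * f q + V p * (G q p * f q))
        = ((n : ℝ) + 1) ^ 2 * ∑' q : X d, ∑ μ, (2 * (G q p * f q) - G q (p + e μ) * f q - G q (p - e μ) * f q)
          + a / ((n : ℝ) + 1) ^ d * ∑' q : X d, ∑ q' ∈ B n (blk n p), G q q' * f q + V p * ∑' q : X d, G q p * f q := by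
      rw [Summable.tsum_add ((hS1s.mul_left _).add (hS2.mul_left _)) ((hs p).mul_left _),
        Summable.tsum_add (hS1s.mul_left _) (hS2.mul_left _), hS1s.tsum_mul_left (((n : ℝ) + 1) ^ 2),
        hS2.tsum_mul_left (a / ((n : ℝ) + 1) ^ d), (hs p).tsum_mul_left (V p)]
    rw [← hpt, hmain, hT1, hT2]
  -- (181): the bounded solution IS the kernel sum
  have huA : u = fun p => ∑' q : X d, G q p * f q :=
    zd_bounded_solution_unique hd a ha hlam hLam n V hV hV' f u (fun p => ∑' q : X d, G q p * f q) huB hAB hu hAeq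
  intro p
  exact congrFun huA p

/-! ## §5. Toy -/

/-- Toy (`d = 3`, `a = 1`, `λ = 0`, `Λ = 1`): the constants of the point-column decay exist. -/
example : ∃ C δ : ℝ, 0 < C ∧ 0 < δ :=
  let ⟨C, δ, hC, hδ, _⟩ := zd_pointColumn_decay (d := 3) le_rfl 1 one_pos (lam := 0) (Lam := 1)
    (by rw [min_eq_right (by norm_num : (1 : ℝ) ≤ 2)]; norm_num) zero_le_one
  ⟨C, δ, hC, hδ⟩

end Summit.QuantumFields.BalabanUV.T4Continuum.NE7b.SupZdPropagatorKernel
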